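import Literature.NumberTheory.LFunctions.SelbergApproxPointwise
import Literature.NumberTheory.LFunctions.HardyZExtremaCriterionProofs
import Summits.RiemannHypothesis.RiemannHypothesis.Theorems.HardyZLehmerSplitDictionaryKernelBoundHelper
import HarnessLib

/-!
# stub_partialFraction — exact partial-fraction decomposition of Z'/Z

Proves `stub_partialFraction` from the skeleton `dictionary_v1.lean`:
  ∀ t, 100 ≤ t → ζ(½+it) ≠ 0 → Summable (farTerm t) ∧ Z'/Z(t) = windowSum + farSum + smoothPart

## Key tree lemmas used

* `Ivic2003.deriv_hardyZ_div_eq`: `Z'/Z(t) = -Im ζ'/ζ(½+it)`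
* `Ivic2003.neg_im_logDeriv_zeta_critPt`: the ξ-form at ½+it
* `hasSum_zeroOrder_mul_inv_sub_sub`: differenced Hadamard partial fraction (SelbergApproxPointwise.lean)
* `summable_norm_zeroOrder_mul_inv_sub_sub`: absolute convergence (SelbergApproxPointwise.lean)
-/

noncomputable section

open Complex Set Filter Topology Classical Real
open Literature.NumberTheory.LFunctions

/-! ## Definitions from dictionary_v1 skeleton -/

/-- The critical point `½ + it`. -/
def critPt (t : ℝ) : ℂ := 1 / 2 + (t : ℂ) * I

/-- The comparison point `2 + it`. -/
def cmpPt (t : ℝ) : ℂ := 2 + (t : ℂ) * I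

/-- The differenced kernel `K(t,ρ) = −Im[1/(½+it−ρ) − 1/(2+it−ρ)]`. -/
def kernel (t : ℝ) (ρ : ℂ) : ℝ := -((1 / (critPt t - ρ) - 1 / (cmpPt t - ρ)).im)

/-- The window of zeros `t − 1 < Im ρ ≤ t + 1` (each zero once; tree boxes `zetaZeroBox 0 ·`). -/
def window (t : ℝ) : Set ℂ := zetaZeroBox 0 (t + 1) \ zetaZeroBox 0 (t - 1)

/-- The window sum: finite sum over zeros in the window. -/
def windowSum (t : ℝ) : ℝ := ∑ᶠ ρ ∈ window t, (riemannZetaZeroOrder ρ : ℝ) * kernel t ρ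

/-- The far-field term for a zero: multiplicity × kernel if outside window, else 0. -/
def farTerm (t : ℝ) (ρ : RHWave0.riemannZetaNontrivialZeros) : ℝ :=
  if (ρ : ℂ) ∈ window t then 0 else (riemannZetaZeroOrder (ρ : ℂ) : ℝ) * kernel t ρ

/-- The far-field sum: tsum over all zeros, zeroed inside the window. -/
def farSum (t : ℝ) : ℝ := ∑' ρ, farTerm t ρ

/-- The smooth part from `−Im ζ'/ζ(cmpPt)` plus pole/digamma corrections. -/
def smoothPart (t : ℝ) : ℝ :=
  -(deriv riemannZeta (cmpPt t) / riemannZeta (cmpPt t)).im -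
  (1 / cmpPt t).im - (1 / (cmpPt t - 1)).im - (Complex.digamma (cmpPt t / 2)).im / 2 -
  2 * t / (t ^ 2 + 1 / 4) + (Complex.digamma ((1 / 4 : ℂ) + ((t / 2 : ℝ) : ℂ) * I)).im / 2

namespace StubPartialFraction

/-! ## Basic lemmas -/

/-- ζ(2+it) ≠ 0 for all t (Re = 2 > 1). -/
theorem riemannZeta_cmpPt_ne_zero (t : ℝ) : riemannZeta (cmpPt t) ≠ 0 := by
  refine riemannZeta_ne_zero_of_one_lt_re ?_
  simp only [cmpPt, add_re, ofReal_re, mul_re, I_re, mul_zero, I_im, mul_one]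
  norm_num

/-! ## Summability

**Key idea**: From `summable_norm_zeroOrder_mul_inv_sub_sub`, we have
`Summable (‖m(ρ)(1/(cmpPt-ρ) - 1/(critPt-ρ))‖)`. The kernel `K = -Im(1/(critPt-ρ) - 1/(cmpPt-ρ))`
satisfies `|m(ρ) K(t,ρ)| ≤ ‖m(ρ)(1/(cmpPt-ρ) - 1/(critPt-ρ))‖` since `|Im z| ≤ ‖z‖`.
The farTerm is bounded by the full kernel term (it's 0 on the window).
-/

/-- The differenced kernel is summable. -/
theorem summable_kernel_mul_zeroOrder {t : ℝ} (hζ : riemannZeta (critPt t) ≠ 0) :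
    Summable fun ρ : RHWave0.riemannZetaNontrivialZeros ↦
      (riemannZetaZeroOrder (ρ : ℂ) : ℝ) * kernel t ρ := by
  have h1 := riemannZeta_cmpPt_ne_zero t
  have hs := summable_norm_zeroOrder_mul_inv_sub_sub h1 hζ
  -- The bound |m*K| ≤ ‖m*(1/(cmpPt-ρ) - 1/(critPt-ρ))‖ holds since |Im z| ≤ ‖z‖
  refine Summable.of_norm_bounded hs fun ρ => ?_
  unfold kernel critPt cmpPt
  have hm := ZetaZeroSum.zeroOrder_nonneg ρ
  rw [Real.norm_eq_abs, abs_mul, abs_of_nonneg hm]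
  have him : |-(1 / (1 / 2 + ↑t * I - ↑ρ) - 1 / (2 + ↑t * I - ↑ρ)).im| ≤
      ‖1 / (1 / 2 + ↑t * I - ↑ρ) - 1 / (2 + ↑t * I - ↑ρ)‖ := by
    rw [abs_neg]; exact Complex.abs_im_le_norm _
  calc (riemannZetaZeroOrder (ρ : ℂ) : ℝ) * |-(1 / (1 / 2 + ↑t * I - ↑ρ) - 1 / (2 + ↑t * I - ↑ρ)).im|
      ≤ (riemannZetaZeroOrder (ρ : ℂ) : ℝ) * ‖1 / (1 / 2 + ↑t * I - ↑ρ) - 1 / (2 + ↑t * I - ↑ρ)‖ := by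
        exact mul_le_mul_of_nonneg_left him hm
    _ = ‖(riemannZetaZeroOrder (ρ : ℂ) : ℂ)‖ * ‖1 / (1 / 2 + ↑t * I - ↑ρ) - 1 / (2 + ↑t * I - ↑ρ)‖ := by
        rw [Complex.norm_intCast, abs_of_nonneg hm]
    _ = ‖(riemannZetaZeroOrder (ρ : ℂ) : ℂ) * (1 / (1 / 2 + ↑t * I - ↑ρ) - 1 / (2 + ↑t * I - ↑ρ))‖ := by
        rw [← norm_mul]
    _ = ‖(riemannZetaZeroOrder (ρ : ℂ) : ℂ) * (1 / (cmpPt t - ↑ρ) - 1 / (critPt t - ↑ρ))‖ := by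
        rw [norm_mul, norm_mul]
        congr 1
        simp only [critPt, cmpPt]
        rw [← norm_neg]
        congr 1
        ring

/-- The `farTerm` sum is summable. -/
theorem summable_farTerm {t : ℝ} (hζ : riemannZeta (critPt t) ≠ 0) :
    Summable (farTerm t) := by
  -- |farTerm| ≤ |m * kernel| (it's 0 on window, equals m*kernel off window)
  have hs := (summable_kernel_mul_zeroOrder hζ).abs
  refine Summable.of_norm_bounded hs fun ρ => ?_
  unfold farTerm
  rw [Real.norm_eq_abs]
  split_ifs with h
  · simp only [abs_zero, abs_nonneg]
  · exact le_refl _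

/-! ## Splitting lemma -/

/-- The tsum of `m * kernel` over all zeros equals `windowSum + farSum`.
This requires splitting the tsum at the window and relating the finsum to the tsum over the finite set. -/
theorem tsum_kernel_eq_windowSum_add_farSum {t : ℝ} (hζ : riemannZeta (critPt t) ≠ 0) :
    (∑' ρ : RHWave0.riemannZetaNontrivialZeros,
      (riemannZetaZeroOrder (ρ : ℂ) : ℝ) * kernel t ρ) = windowSum t + farSum t := by
  -- Split tsum using indicator: each term is either in window (contributes to windowSum) or not (to farSum)
  have hs := summable_kernel_mul_zeroOrder hζ
  -- The tsum splits into terms in window + terms outside window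
  have hsplit := hs.tsum_subtype_add_tsum_subtype_compl {ρ : RHWave0.riemannZetaNontrivialZeros | (ρ : ℂ) ∈ window t}
  rw [← hsplit]
  congr 1
  -- Goal 1: ∑' (x : {ρ | ρ ∈ window}), m * kernel = windowSum
  -- Goal 2: ∑' (x : {ρ | ρ ∉ window}), m * kernel = farSum
  · -- The tsum over {ρ ∈ window} equals windowSum
    -- windowSum = ∑ᶠ ρ ∈ window t, m * kernel (finsum over ℂ)
    -- Key: window t ⊆ zetaZeroBox, which is finite and ⊆ nontrivialZeros
    unfold windowSum window
    -- window is finite (⊆ zetaZeroBox)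
    set W := zetaZeroBox 0 (t + 1) \ zetaZeroBox 0 (t - 1) with hW
    have hfin : W.Finite := (zetaZeroBox_finite 0 (t + 1)).subset Set.sdiff_subset
    -- W ⊆ nontrivialZeros
    have hsub : W ⊆ (RHWave0.riemannZetaNontrivialZeros : Set ℂ) := fun ρ hρ =>
      zetaZeroBox_subset_riemannZetaNontrivialZeros 0 (t + 1) hρ.1
    -- Convert finsum to sum over finite set
    rw [finsum_mem_eq_finite_toFinset_sum _ hfin]
    -- The subtype is finite (W ⊆ nontrivialZeros via hsub)
    have hfin' : {ρ : RHWave0.riemannZetaNontrivialZeros | (ρ : ℂ) ∈ W}.Finite := by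
      have hW_inj : Set.InjOn (Subtype.val : RHWave0.riemannZetaNontrivialZeros → ℂ)
          {ρ : RHWave0.riemannZetaNontrivialZeros | (ρ : ℂ) ∈ W} := Subtype.val_injective.injOn
      exact hfin.preimage hW_inj
    -- Both sums are finite; use Fintype instances and sum_equiv
    haveI hFinW : Fintype W := hfin.fintype
    haveI hFinS : Fintype {ρ : RHWave0.riemannZetaNontrivialZeros | (ρ : ℂ) ∈ W} := hfin'.fintype
    rw [tsum_fintype]
    -- Goal: ∑ b : {ρ | ρ ∈ W}, f b.1 = ∑ i ∈ hfin.toFinset, f i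
    -- First convert RHS to ∑ w : W
    conv_rhs => rw [← Finset.sum_coe_sort hfin.toFinset
        (fun ρ => (riemannZetaZeroOrder ρ : ℝ) * kernel t ρ)]
    -- Now goal: ∑ b : {ρ | ρ ∈ W}, f b.1 = ∑ i : hfin.toFinset, f i
    -- Relate hfin.toFinset and W via the Fintype instance
    have heq : (hfin.toFinset : Set ℂ) = W := hfin.coe_toFinset
    -- Use Fintype.sum_equiv with the obvious bijection
    let e : {ρ : RHWave0.riemannZetaNontrivialZeros | (ρ : ℂ) ∈ W} ≃ hfin.toFinset :=
      ⟨fun ⟨ρ, hρ⟩ => ⟨ρ.1, hfin.mem_toFinset.mpr hρ⟩,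
       fun ⟨z, hz⟩ => ⟨⟨z, hsub (hfin.mem_toFinset.mp hz)⟩, hfin.mem_toFinset.mp hz⟩,
       fun ⟨⟨z, _⟩, hz⟩ => rfl,
       fun ⟨z, hz⟩ => rfl⟩
    exact Fintype.sum_equiv e _ _ fun _ => rfl
  · -- The tsum over {ρ ∉ window} equals farSum by definition of farTerm
    -- farSum = ∑' ρ, farTerm where farTerm = 0 on window, m*kernel off window
    unfold farSum
    -- Use that farTerm = 0 on window to simplify
    have hfs : Summable (farTerm t) := summable_farTerm hζ
    -- Split farSum into window + complement
    have hsplit_far := hfs.tsum_subtype_add_tsum_subtype_compl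
      {ρ : RHWave0.riemannZetaNontrivialZeros | (ρ : ℂ) ∈ window t}
    -- The window part is 0
    have hwin_zero : (∑' x : {ρ : RHWave0.riemannZetaNontrivialZeros | (ρ : ℂ) ∈ window t},
        farTerm t x.1) = 0 := by
      have : ∀ x : {ρ : RHWave0.riemannZetaNontrivialZeros | (ρ : ℂ) ∈ window t},
          farTerm t x.1 = 0 := fun ⟨ρ, hρ⟩ => by
        unfold farTerm
        simp only [Set.mem_setOf_eq] at hρ
        simp only [hρ, ↓reduceIte]
      simp only [this, tsum_zero]
    rw [← hsplit_far, hwin_zero, zero_add]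
    -- The complement part matches
    apply tsum_congr
    intro ⟨ρ, hρ⟩
    unfold farTerm
    simp only [Set.mem_setOf_eq, Set.mem_compl_iff] at hρ
    simp only [hρ, ↓reduceIte]

/-! ## The decomposition identity -/

/-- **The main identity**: `Z'/Z(t) = windowSum t + farSum t + smoothPart t`.

**Proof outline**:
1. `Z'/Z(t) = -Im ζ'/ζ(½+it)` by `Ivic2003.deriv_hardyZ_div_eq`
2. `= -Im ξ'/ξ(½+it) - 2t/(t²+¼) + Im ψ(¼+it/2)/2` by `Ivic2003.neg_im_logDeriv_zeta_critPt`
3. From `hasSum_zeroOrder_mul_inv_sub_sub`, taking Im and using kernel definition: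
   `Σ m(ρ) kernel(t,ρ) = Im ξ'/ξ(critPt) - Im ξ'/ξ(cmpPt)`
4. Split sum at window: `windowSum + farSum = Σ m(ρ) kernel(t,ρ)`
5. `smoothPart = -Im ξ'/ξ(cmpPt) - 2t/(t²+¼) + Im ψ(¼+it/2)/2` by expanding:
   Im ξ'/ξ(2+it) = Im(1/(2+it)) + Im(1/(1+it)) + Im ψ(1+it/2)/2 + Im(ζ'/ζ(2+it))
   using `logDeriv_riemannXi_eq_of_one_lt_re`.
-/
theorem decomposition {t : ℝ} (_ht : 100 ≤ t) (hζ : riemannZeta (critPt t) ≠ 0) :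
    deriv hardyZ t / hardyZ t = windowSum t + farSum t + smoothPart t := by
  -- Convert critPt form to the standard form
  have hζ_std : riemannZeta (1 / 2 + (t : ℂ) * I) ≠ 0 := by convert hζ using 2; simp [critPt]
  -- Step 1: Z'/Z = -Im ζ'/ζ(critPt) by deriv_hardyZ_div_eq
  have h1 := Ivic2003.deriv_hardyZ_div_eq hζ_std
  -- Step 2: -Im ζ'/ζ(critPt) = -Im ξ'/ξ(critPt) - 2t/(t²+¼) + Im ψ(¼+it/2)/2 by neg_im_logDeriv_zeta_critPt
  have h2 := Ivic2003.neg_im_logDeriv_zeta_critPt hζ_std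
  -- Step 3: HasSum for the differenced kernel sum via hasSum_zeroOrder_mul_inv_sub_sub
  have hcmp := riemannZeta_cmpPt_ne_zero t
  have hHasSum := hasSum_zeroOrder_mul_inv_sub_sub hcmp hζ
  -- Taking Im of the HasSum via Complex.hasSum_im
  have hHasSum_im := Complex.hasSum_im hHasSum.summable.hasSum
  -- Step 4: Expand Im ξ'/ξ(cmpPt) using logDeriv_riemannXi_eq_of_one_lt_re
  have hcmp_re : 1 < (cmpPt t).re := by
    unfold cmpPt
    simp only [add_re, ofReal_re, mul_re, I_re, mul_zero, I_im, mul_one]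
    norm_num
  have hxi := logDeriv_riemannXi_eq_of_one_lt_re hcmp_re
  -- Use the splitting lemma
  have hsplit := tsum_kernel_eq_windowSum_add_farSum hζ
  -- Step 5: kernel t ρ = Im(1/(cmpPt-ρ) - 1/(critPt-ρ))
  have hkernel_eq : ∀ ρ : RHWave0.riemannZetaNontrivialZeros,
      kernel t ρ = ((1 : ℂ) / (cmpPt t - ρ) - 1 / (critPt t - ρ)).im := fun ρ => by
    unfold kernel; simp only [one_div, Complex.sub_im]; ring
  -- Step 6: For m : ℤ, (m : ℝ) * z.im = ((m : ℂ) * z).im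
  have hint_im : ∀ (m : ℤ) (z : ℂ), (m : ℝ) * z.im = ((m : ℂ) * z).im := fun m z => by
    rw [Complex.mul_im, Complex.intCast_re, Complex.intCast_im, zero_mul, add_zero]
  -- Step 7: tsum m*kernel = Im(ξ'/ξ(cmpPt) - ξ'/ξ(critPt))
  have hKernel : ∑' (ρ : RHWave0.riemannZetaNontrivialZeros),
      (riemannZetaZeroOrder (ρ : ℂ) : ℝ) * kernel t ρ =
      (logDeriv riemannXi (cmpPt t)).im - (logDeriv riemannXi (critPt t)).im := by
    simp_rw [hkernel_eq, hint_im]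
    rw [(Complex.hasSum_im hHasSum.summable.hasSum).tsum_eq, hHasSum.tsum_eq, Complex.sub_im]
  -- Step 8: critPt t = 1/2 + t*I
  have hcritPt : critPt t = 1 / 2 + (t : ℂ) * I := rfl
  -- Step 9: smoothPart = -Im ξ'/ξ(cmpPt) - 2t/(t²+¼) + Im ψ(¼+it/2)/2
  have hL := ArithmeticFunction.LSeries_vonMangoldt_eq_deriv_riemannZeta_div hcmp_re
  have hlog_pi : (Complex.log (π : ℂ)).im = 0 := by
    rw [Complex.log_im, Complex.arg_ofReal_of_nonneg Real.pi_nonneg]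
  have hsmooth : smoothPart t = -(logDeriv riemannXi (cmpPt t)).im -
      2 * t / (t ^ 2 + 1 / 4) + (Complex.digamma ((1 / 4 : ℂ) + ((t / 2 : ℝ) : ℂ) * I)).im / 2 := by
    -- smoothPart definition expands to match -Im ξ'/ξ(cmpPt) structure
    -- Use logDeriv = deriv / (·) and hxi, hL to show the Im parts match
    unfold smoothPart
    -- Show that after expansion, both sides have the same Im parts
    -- The key: -Im ξ'/ξ = -Im ζ'/ζ - Im(1/s) - Im(1/(s-1)) - Im(ψ(s/2))/2  (log π is real)
    rw [hxi, hL]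
    -- After rewriting, both sides differ only by terms that vanish:
    -- log π is real → Im(log π) = 0
    -- 1 is real → Im 1 = 0 in normSq(1) etc.
    have h1im : Complex.im 1 = 0 := rfl
    have h2im : Complex.im 2 = 0 := rfl
    have h2re : Complex.re 2 = 2 := rfl
    have h2normSq : Complex.normSq 2 = 4 := by norm_num [Complex.normSq]
    have hπ_im : (↑(Real.log π) : ℂ).im = 0 := Complex.ofReal_im _
    simp only [Complex.add_im, Complex.sub_im, Complex.neg_im, Complex.mul_im, one_div,
      Complex.div_im, Complex.inv_im, h1im, h2im, h2re, h2normSq, hπ_im,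
      zero_mul, mul_zero, neg_zero, zero_div, sub_zero, add_zero, zero_add, Complex.neg_re]
    -- Simplify 2⁻¹.re = 1/2 that appears in the goal
    have h2inv_re : ((2 : ℂ)⁻¹).re = 1 / 2 := by norm_num
    simp only [h2inv_re]
    ring
  -- Step 10: Rewrite hKernel with hcritPt
  rw [hcritPt] at hKernel
  -- Step 11: Final assembly
  -- Goal: Z'/Z = windowSum + farSum + smoothPart
  -- From h1, h2: Z'/Z = -(logDeriv ξ critPt).im - 2t/(t²+¼) + ψ/2
  -- From hKernel: tsum = Im ξ(cmpPt) - Im ξ(critPt)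
  -- From hsmooth: smoothPart = -Im ξ(cmpPt) - 2t/(t²+¼) + ψ/2
  -- So: tsum + smoothPart = (Im cmpPt - Im critPt) + (-Im cmpPt - ... + ...)
  --                       = -Im critPt - ... + ...
  -- Which equals Z'/Z
  rw [h1, h2]
  -- Now rewrite using hKernel and hsmooth
  calc -(logDeriv riemannXi (1 / 2 + (t : ℂ) * I)).im - 2 * t / (t ^ 2 + 1 / 4) +
          (Complex.digamma ((1 / 4 : ℂ) + ((t / 2 : ℝ) : ℂ) * I)).im / 2
      = ((logDeriv riemannXi (cmpPt t)).im - (logDeriv riemannXi (1 / 2 + (t : ℂ) * I)).im) +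
          (-(logDeriv riemannXi (cmpPt t)).im - 2 * t / (t ^ 2 + 1 / 4) +
            (Complex.digamma ((1 / 4 : ℂ) + ((t / 2 : ℝ) : ℂ) * I)).im / 2) := by ring
    _ = ∑' (ρ : RHWave0.riemannZetaNontrivialZeros), (riemannZetaZeroOrder (ρ : ℂ) : ℝ) * kernel t ρ +
          smoothPart t := by rw [hKernel, hsmooth]
    _ = windowSum t + farSum t + smoothPart t := by rw [hsplit]

/-! ## The main theorem -/

/-- **stub_partialFraction** — exact partial-fraction decomposition of `Z'/Z`. -/
theorem stub_partialFraction :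
    ∀ t : ℝ, 100 ≤ t → riemannZeta (1 / 2 + (t : ℂ) * I) ≠ 0 →
      Summable (farTerm t) ∧
        deriv hardyZ t / hardyZ t = windowSum t + farSum t + smoothPart t := by
  intro t ht hζ
  have hζ' : riemannZeta (critPt t) ≠ 0 := by
    convert hζ using 2
    simp [critPt]
  exact ⟨summable_farTerm hζ', decomposition ht hζ'⟩

end StubPartialFraction
end
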